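import Summits.KontsevichZagierPeriods.KontsevichZagierPeriods.Theorems.SoloInformedCircleSubst
import HarnessLib
import HarnessLib.Audit

/-!
# SoloInformed — the generic one-move substitution lemma; the period conjecture for integrands rational in `(x, √(1+x²))`

Solo programme `solo-KontsevichZagierPeriods-informed`, session s112, file 26.

1. `soloInformed_exists_subst` (any dimension `n`): a `ℚ`-semialgebraic map `Φ` on a
   set `S₀ ⊆ ℝⁿ`, injective on `S₀`, differentiable at the points of `S₀` with a
   derivative whose `|det|` is `ℚ`-semialgebraic on `S₀`, and a representation `R = [D, f]` with
   `D ⊆ Φ(S₀)` give a representation `R' = [ {t ∈ S₀ | Φ t ∈ D}, f(Φ t) |det Φ'(t)| ]` with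
   `[R'] − [R] ∈ changeOfVariablesRel` — ONE move of rule (2) (semialgebraicity of the new domain by
   Tarski–Seidenberg, absolute convergence by the change-of-variables formula).  Files 24–25 are
   instances; here it is packaged once.
2. Instance `Φ(t) = (t² − 1)/(2t)` on `t > 0`, a bijection onto `ℝ` with inverse
   `τ(x) = x + √(1 + x²)` and `|Φ'(t)| = (1 + t²)/(2t²)`.  Functions rational in `(x, √(1 + x²))`
   with real algebraic coefficients are `P(τ(x))/Q(τ(x))`, `P, Q ∈ K[X]` (`x = (τ² − 1)/(2τ)`,
   `√(1 + x²) = (τ² + 1)/(2τ)`): the class `SoloInformedIsKHypOne` (ANY `ℚ`-semialgebraic `D ⊆ ℝ`).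
   After the substitution the integrand is `K`-rational, so (`soloInformed_kzp_isKHypOne`) **the
   Kontsevich–Zagier period conjecture holds between any two absolutely convergent integrals of
   functions rational in `(x, √(1 + x²))` with real algebraic coefficients, and between these and
   the circle class of file 25, the `K`-rational class and rational representations of dimension
   `≤ 1`, whenever the values agree** (e.g. `∫₀¹ dx/√(1 + x²) = log(1 + √2)`).

References: M. Kontsevich, D. Zagier, *Periods* (2001), §1.1–1.2; Bochnak–Coste–Roy (1998),
Prop. 2.2.7; A. Baker (1975), Thm. 2.1.
-/

noncomputable section

open scoped BigOperators Polynomial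

namespace Summit.KontsevichZagierPeriods.KontsevichZagierPeriods.Theorems

open Set MeasureTheory
open Literature.ModelTheory.ExponentialFields
open Literature.NumberTheory.Transcendental Literature.NumberTheory.Transcendental.KZ

/-! ## The generic substitution move -/

/-- **One-move substitution lemma** (any dimension). See the module docstring.
[Kontsevich–Zagier 2001, §1.2 rule (2); BCR 1998, Prop. 2.2.7] -/
theorem soloInformed_exists_subst {n : ℕ} (Φ : (Fin n → ℝ) → (Fin n → ℝ))
    (Φ' : (Fin n → ℝ) → (Fin n → ℝ) →L[ℝ] (Fin n → ℝ)) {S₀ : Set (Fin n → ℝ)}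
    (hΦ : IsSemialgebraicMapOn ℚ S₀ Φ)
    (hderiv : ∀ t ∈ S₀, HasFDerivAt Φ (Φ' t) t) (hinj : InjOn Φ S₀)
    (hjac : IsSemialgebraicFunOn ℚ S₀ fun t => |(Φ' t).det|)
    (R : IntegralRep n) (hsurj : R.domain ⊆ Φ '' S₀) :
    ∃ R' : IntegralRep n, R'.domain = {t | t ∈ S₀ ∧ Φ t ∈ R.domain} ∧
      (R'.integrand = fun t => R.integrand (Φ t) * |(Φ' t).det|) ∧
      of R' - of R ∈ changeOfVariablesRel := by
  set S : Set (Fin n → ℝ) := {t | t ∈ S₀ ∧ Φ t ∈ R.domain} with hSdef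
  have hS : IsSemialgebraic ℚ S := soloInformed_isSemialgebraic_sep_mapsTo hΦ R.isSemialgebraic_domain
  have hSS₀ : S ⊆ S₀ := fun t ht => ht.1
  have hmaps : ∀ t ∈ S, Φ t ∈ R.domain := fun t ht => ht.2
  have hΦS : IsSemialgebraicMapOn ℚ S Φ := hΦ.mono hSS₀ hS
  have hderivS : ∀ t ∈ S, HasFDerivWithinAt Φ (Φ' t) S t :=
    fun t ht => (hderiv t ht.1).hasFDerivWithinAt
  have hinjS : InjOn Φ S := hinj.mono hSS₀
  have himage : Φ '' S = R.domain := by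
    refine Subset.antisymm (fun x ⟨t, ht, htx⟩ => htx ▸ ht.2) fun x hx => ?_
    obtain ⟨t, ht, rfl⟩ := hsurj hx
    exact ⟨t, ⟨ht, hx⟩, rfl⟩
  have hfun : IsSemialgebraicFunOn ℚ S (fun t => R.integrand (Φ t) * |(Φ' t).det|) :=
    (IsSemialgebraicFunOn.mul_holds
      (IsSemialgebraicFunOn.comp_isSemialgebraicMapOn_holds R.isSemialgebraicFunOn_integrand hΦS
        hmaps) (hjac.mono hSS₀ hS)).congr fun _ _ => rfl
  have hint : IntegrableOn (fun t => R.integrand (Φ t) * |(Φ' t).det|) S := by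
    have h := (integrableOn_image_iff_integrableOn_abs_det_fderiv_smul volume
      (IsSemialgebraic.measurableSet_holds hS) hderivS hinjS R.integrand).1 (by
        rw [himage]; exact R.integrableOn)
    refine h.congr_fun (fun t _ => ?_) (IsSemialgebraic.measurableSet_holds hS)
    show |(Φ' t).det| • R.integrand (Φ t) = _
    rw [smul_eq_mul, mul_comm]
  refine ⟨⟨S, _, hS, hfun, hint⟩, rfl, rfl, ?_⟩
  exact ⟨n, ⟨S, _, hS, hfun, hint⟩, R, Φ, Φ', hΦS, hderivS, hinjS, himage.symm, fun t _ => rfl, rfl⟩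

/-- Corollary: if the pulled-back representation lies in the span of points and segments, so does
`R`. -/
theorem soloInformed_segSpan_of_subst {n : ℕ} {R R' : IntegralRep n}
    (hrel : of R' - of R ∈ changeOfVariablesRel) (hR' : of R' ∈ soloInformedSegSpan) :
    of R ∈ soloInformedSegSpan := by
  have h1 : of R - of R' ∈ relations := by
    have h := relations.neg_mem (changeOfVariablesRel_subset_relations hrel)
    rwa [neg_sub] at h
  exact soloInformed_mem_segSpan_of_sub_mem h1 hR'

/-! ## The substitution `x = (t² − 1)/(2t)` -/

/-- `Φ(t) = (t² − 1)/(2t)`. -/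
def soloInformedHypMap (w : Fin 1 → ℝ) : Fin 1 → ℝ := fun _ => (w 0 * w 0 - 1) / (2 * w 0)

/-- `Φ'(t) = ((1 + t²)/(2t²)) • id`. -/
def soloInformedHypDeriv (w : Fin 1 → ℝ) : (Fin 1 → ℝ) →L[ℝ] (Fin 1 → ℝ) :=
  ((1 + w 0 * w 0) / (2 * (w 0 * w 0))) • ContinuousLinearMap.id ℝ (Fin 1 → ℝ)

/-- `τ(x) = x + √(1 + x²)`, the inverse of `Φ` (`ℝ → (0, ∞)`). -/
def soloInformedHypInv (x : ℝ) : ℝ := x + Real.sqrt (1 + x ^ 2)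

/-- Pointwise formula. -/
@[simp] theorem soloInformed_hypMap_apply (w : Fin 1 → ℝ) (i : Fin 1) :
    soloInformedHypMap w i = (w 0 * w 0 - 1) / (2 * w 0) := rfl

/-- The scalar derivative of `s ↦ (s² − 1)/(2s)` at `s ≠ 0`. -/
theorem soloInformed_hasDerivAt_hyp {s : ℝ} (hs : s ≠ 0) :
    HasDerivAt (fun y : ℝ => (y * y - 1) / (2 * y)) ((1 + s * s) / (2 * (s * s))) s := by
  have hsq : HasDerivAt (fun y : ℝ => y * y) (1 * s + s * 1) s := (hasDerivAt_id s).mul (hasDerivAt_id s)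
  have hc : HasDerivAt (fun y : ℝ => y * y - 1) (1 * s + s * 1 - 0) s := hsq.sub (hasDerivAt_const s 1)
  have hd : HasDerivAt (fun y : ℝ => 2 * y) (2 * 1) s := (hasDerivAt_id s).const_mul 2
  refine (hc.div hd (by positivity)).congr_deriv ?_
  field_simp
  ring

/-- `Φ` is differentiable at `t ≠ 0` with the stated derivative. -/
theorem soloInformed_hasFDerivAt_hypMap {w : Fin 1 → ℝ} (hw : w 0 ≠ 0) :
    HasFDerivAt soloInformedHypMap (soloInformedHypDeriv w) w := by
  rw [hasFDerivAt_pi']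
  intro i
  have h1 : HasFDerivAt (fun w : Fin 1 → ℝ => w 0)
      (ContinuousLinearMap.proj (R := ℝ) (φ := fun _ : Fin 1 => ℝ) 0) w :=
    (ContinuousLinearMap.proj (R := ℝ) (φ := fun _ : Fin 1 => ℝ) 0).hasFDerivAt
  have h2 := (soloInformed_hasDerivAt_hyp hw).comp_hasFDerivAt w h1
  refine h2.congr_fderiv ?_
  ext v
  simp [soloInformedHypDeriv, Fin.fin_one_eq_zero i]

/-- The Jacobian determinant of `Φ`; it is positive for `t ≠ 0`. -/
theorem soloInformed_det_hypDeriv (w : Fin 1 → ℝ) :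
    (soloInformedHypDeriv w).det = (1 + w 0 * w 0) / (2 * (w 0 * w 0)) := by
  unfold soloInformedHypDeriv
  rw [ContinuousLinearMap.det, ContinuousLinearMap.toLinearMap_smul, ContinuousLinearMap.coe_id,
    LinearMap.det_smul, LinearMap.det_id, Module.finrank_fin_fun]
  simp

/-- `|det Φ'(t)| = (1 + t²)/(2t²)`. -/
theorem soloInformed_abs_det_hypDeriv (w : Fin 1 → ℝ) :
    |(soloInformedHypDeriv w).det| = (1 + w 0 * w 0) / (2 * (w 0 * w 0)) := by
  rw [soloInformed_det_hypDeriv]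
  exact abs_of_nonneg (div_nonneg (add_nonneg zero_le_one (mul_self_nonneg _))
    (mul_nonneg zero_le_two (mul_self_nonneg _)))

/-- `Φ` is `ℚ`-semialgebraic on every `ℚ`-semialgebraic subset of `{t ≠ 0}`. -/
theorem soloInformed_isSemialgebraicMapOn_hypMap {s : Set (Fin 1 → ℝ)} (hs : IsSemialgebraic ℚ s)
    (hs0 : ∀ w ∈ s, w 0 ≠ 0) : IsSemialgebraicMapOn ℚ s soloInformedHypMap := by
  refine IsSemialgebraicMapOn.of_forall hs fun i => ?_
  refine (isSemialgebraicFunOn_aeval_div_aeval hs (MvPolynomial.X 0 ^ 2 - 1 : MvPolynomial (Fin 1) ℚ)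
    (MvPolynomial.C (2 : ℚ) * MvPolynomial.X 0) fun v hv => ?_).congr fun v _ => ?_
  · simp only [map_mul, MvPolynomial.aeval_C, MvPolynomial.aeval_X, eq_ratCast, Rat.cast_ofNat]
    exact mul_ne_zero two_ne_zero (hs0 v hv)
  · show (MvPolynomial.aeval v (MvPolynomial.X 0 ^ 2 - 1 : MvPolynomial (Fin 1) ℚ) : ℝ) /
        MvPolynomial.aeval v (MvPolynomial.C (2 : ℚ) * MvPolynomial.X 0 : MvPolynomial (Fin 1) ℚ) =
      soloInformedHypMap v i
    simp [soloInformedHypMap, pow_two]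

/-- `|det Φ'|` is `ℚ`-semialgebraic on every `ℚ`-semialgebraic subset of `{t ≠ 0}`. -/
theorem soloInformed_isSemialgebraicFunOn_abs_det_hypDeriv {s : Set (Fin 1 → ℝ)}
    (hs : IsSemialgebraic ℚ s) (hs0 : ∀ w ∈ s, w 0 ≠ 0) :
    IsSemialgebraicFunOn ℚ s fun t => |(soloInformedHypDeriv t).det| := by
  refine (isSemialgebraicFunOn_aeval_div_aeval hs (1 + MvPolynomial.X 0 ^ 2 : MvPolynomial (Fin 1) ℚ)
    (MvPolynomial.C (2 : ℚ) * MvPolynomial.X 0 ^ 2) fun v hv => ?_).congr fun v _ => ?_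
  · simp only [map_mul, map_pow, MvPolynomial.aeval_C, MvPolynomial.aeval_X, eq_ratCast, Rat.cast_ofNat]
    exact mul_ne_zero two_ne_zero (pow_ne_zero _ (hs0 v hv))
  · show (MvPolynomial.aeval v (1 + MvPolynomial.X 0 ^ 2 : MvPolynomial (Fin 1) ℚ) : ℝ) /
        MvPolynomial.aeval v (MvPolynomial.C (2 : ℚ) * MvPolynomial.X 0 ^ 2 : MvPolynomial (Fin 1) ℚ) =
      |(soloInformedHypDeriv v).det|
    rw [soloInformed_abs_det_hypDeriv]
    simp [pow_two]

/-- `Φ` is injective on `{t | 0 < t 0}`. -/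
theorem soloInformed_injOn_hypMap : InjOn soloInformedHypMap {t : Fin 1 → ℝ | 0 < t 0} := by
  intro a ha b hb h
  have ha0 : 0 < a 0 := ha
  have hb0 : 0 < b 0 := hb
  have h0 : (a 0 * a 0 - 1) / (2 * a 0) = (b 0 * b 0 - 1) / (2 * b 0) := congr_fun h 0
  rw [div_eq_div_iff (by positivity) (by positivity)] at h0
  have hab : a 0 = b 0 := by
    have h1 : (a 0 - b 0) * (a 0 * b 0 + 1) = 0 := by nlinarith [h0]
    rcases mul_eq_zero.1 h1 with h | h
    · linarith
    · nlinarith [mul_pos ha0 hb0]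
  rw [KZ.eq_const_apply_zero a, KZ.eq_const_apply_zero b, hab]

/-- `τ(x) > 0`, and `Φ(τ(x)) = x`. -/
theorem soloInformed_hypMap_hypInv (x : ℝ) :
    0 < soloInformedHypInv x ∧
      (soloInformedHypInv x * soloInformedHypInv x - 1) / (2 * soloInformedHypInv x) = x := by
  have hsq : Real.sqrt (1 + x ^ 2) * Real.sqrt (1 + x ^ 2) = 1 + x ^ 2 :=
    Real.mul_self_sqrt (by positivity)
  have hgt : |x| < Real.sqrt (1 + x ^ 2) := by
    rw [← Real.sqrt_sq_eq_abs]
    exact Real.sqrt_lt_sqrt (sq_nonneg _) (by linarith)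
  have hpos : 0 < soloInformedHypInv x := by
    unfold soloInformedHypInv
    have := neg_abs_le x
    linarith
  refine ⟨hpos, ?_⟩
  rw [div_eq_iff (mul_ne_zero two_ne_zero hpos.ne')]
  unfold soloInformedHypInv at *
  nlinarith [hsq]

/-- For `t > 0`: `τ(Φ(t)) = t`. -/
theorem soloInformed_hypInv_hypMap {t : ℝ} (ht : 0 < t) :
    soloInformedHypInv ((t * t - 1) / (2 * t)) = t := by
  unfold soloInformedHypInv
  have h1 : 1 + ((t * t - 1) / (2 * t)) ^ 2 = ((t * t + 1) / (2 * t)) ^ 2 := by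
    field_simp
    ring
  rw [h1, Real.sqrt_sq (by positivity)]
  field_simp
  ring

/-! ## The class of integrands rational in `(x, √(1 + x²))` -/

/-- `r = [D, f]` of dimension `1` has integrand `P(τ(x))/Q(τ(x))` on `D`, `τ(x) = x + √(1 + x²)`,
for some `P, Q ∈ K[X]` with `Q(τ(x)) ≠ 0` on `D` (functions rational in `(x, √(1 + x²))` with
coefficients in `K` are exactly of this form). -/
def SoloInformedIsKHypOne (r : IntegralRep 1) : Prop :=
  ∃ P Q : (algebraicClosure ℚ ℝ)[X],
    (∀ x ∈ r.domain, (Polynomial.aeval (soloInformedHypInv (x 0)) Q : ℝ) ≠ 0) ∧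
    EqOn r.integrand (fun x => (Polynomial.aeval (soloInformedHypInv (x 0)) P : ℝ) /
      Polynomial.aeval (soloInformedHypInv (x 0)) Q) r.domain

/-- **Members of the class lie in the span of points and segments** (one substitution, then the
integrand `P(t)(1 + t²) / (Q(t) · 2t²)` is `K`-rational: file 18). -/
theorem soloInformed_segSpan_of_isKHypOne (r : IntegralRep 1) (hr : SoloInformedIsKHypOne r) :
    of r ∈ soloInformedSegSpan := by
  obtain ⟨P, Q, hq, hpq⟩ := hr
  have hS₀ : IsSemialgebraic ℚ {t : Fin 1 → ℝ | 0 < t 0} := by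
    have h := (isSemialgebraicFunOn_aeval (isSemialgebraic_univ : IsSemialgebraic ℚ (univ : Set (Fin 1 → ℝ)))
      (-MvPolynomial.X 0 : MvPolynomial (Fin 1) ℚ)).isSemialgebraic_sep_neg
    convert h using 1
    ext t; simp
  have hne : ∀ w ∈ {t : Fin 1 → ℝ | 0 < t 0}, w 0 ≠ 0 := fun w hw => ne_of_gt hw
  obtain ⟨R', hdom, hint, hrel⟩ := soloInformed_exists_subst soloInformedHypMap soloInformedHypDeriv
    (soloInformed_isSemialgebraicMapOn_hypMap hS₀ hne)
    (fun t ht => soloInformed_hasFDerivAt_hypMap (hne t ht)) soloInformed_injOn_hypMap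
    (soloInformed_isSemialgebraicFunOn_abs_det_hypDeriv hS₀ hne) r fun x _ =>
      ⟨fun _ => soloInformedHypInv (x 0), (soloInformed_hypMap_hypInv (x 0)).1, funext fun i => by
        rw [soloInformed_hypMap_apply, (soloInformed_hypMap_hypInv (x 0)).2, Fin.fin_one_eq_zero i]⟩
  refine soloInformed_segSpan_of_subst hrel (soloInformed_segSpan_of_isKRationalOne R' ?_)
  have hmem : ∀ t ∈ R'.domain, 0 < t 0 ∧ soloInformedHypMap t ∈ r.domain := fun t ht => by
    rw [hdom] at ht; exact ht
  have hτ : ∀ t : Fin 1 → ℝ, 0 < t 0 → soloInformedHypInv (soloInformedHypMap t 0) = t 0 :=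
    fun t ht => by rw [soloInformed_hypMap_apply]; exact soloInformed_hypInv_hypMap ht
  refine ⟨P * (1 + Polynomial.X ^ 2), Q * (Polynomial.C (2 : algebraicClosure ℚ ℝ) * Polynomial.X ^ 2),
    fun t ht => ?_, fun t ht => ?_⟩
  · obtain ⟨ht0, hx⟩ := hmem t ht
    have h := hq _ hx
    rw [hτ t ht0] at h
    rw [map_mul, map_mul, map_pow, Polynomial.aeval_X, Polynomial.aeval_C, map_ofNat]
    exact mul_ne_zero h (by positivity)
  · obtain ⟨ht0, hx⟩ := hmem t ht
    rw [hint]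
    show r.integrand (soloInformedHypMap t) * |(soloInformedHypDeriv t).det| = _
    rw [hpq hx, soloInformed_abs_det_hypDeriv]
    show (Polynomial.aeval (soloInformedHypInv (soloInformedHypMap t 0)) P : ℝ) /
        Polynomial.aeval (soloInformedHypInv (soloInformedHypMap t 0)) Q *
          ((1 + t 0 * t 0) / (2 * (t 0 * t 0))) =
      (Polynomial.aeval (t 0) (P * (1 + Polynomial.X ^ 2)) : ℝ) /
        Polynomial.aeval (t 0) (Q * (Polynomial.C (2 : algebraicClosure ℚ ℝ) * Polynomial.X ^ 2))
    have hQ : (Polynomial.aeval (t 0) Q : ℝ) ≠ 0 := by have h := hq _ hx; rwa [hτ t ht0] at h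
    rw [hτ t ht0, map_mul, map_add, map_one, map_pow, Polynomial.aeval_X, map_mul, map_mul, map_pow,
      Polynomial.aeval_X, Polynomial.aeval_C, map_ofNat]
    have h1 : t 0 ≠ 0 := ht0.ne'
    field_simp

/-- **The Kontsevich–Zagier period conjecture for one-variable integrands rational in
`(x, √(1 + x²))` with real algebraic coefficients** (unconditional, any `ℚ`-semialgebraic domains);
likewise against the circle class, the `K`-rational class and rational representations of
dimension `≤ 1`. [Kontsevich–Zagier 2001, §1.2 Question 1; this work] -/
theorem soloInformed_kzp_isKHypOne (r r' : IntegralRep 1) (hr : SoloInformedIsKHypOne r)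
    (hr' : SoloInformedIsKHypOne r') :
    (r.value = r'.value → Equivalent r r') ∧
    (∀ r₁ : IntegralRep 1, SoloInformedIsKCircleOne r₁ → r.value = r₁.value → Equivalent r r₁) ∧
    (∀ r₁ : IntegralRep 1, SoloInformedIsKRationalOne r₁ → r.value = r₁.value → Equivalent r r₁) ∧
    (∀ {n : ℕ} (hn : n ≤ 1) (r₀ : IntegralRep n), r₀.IsRational → r.value = r₀.value →
      Equivalent r r₀) := by
  have h := soloInformed_segSpan_of_isKHypOne r hr
  exact ⟨fun hv => soloInformed_equivalent_of_mem_segSpan h (soloInformed_segSpan_of_isKHypOne r' hr') hv,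
    fun r₁ hr₁ hv => soloInformed_equivalent_of_mem_segSpan h
      (soloInformed_segSpan_of_isKCircleOne r₁ hr₁) hv,
    fun r₁ hr₁ hv => soloInformed_equivalent_of_mem_segSpan h
      (soloInformed_segSpan_of_isKRationalOne r₁ hr₁) hv,
    fun hn r₀ hr₀ hv => soloInformed_equivalent_of_mem_segSpan h
      (soloInformed_of_mem_segSpan_of_isRational hn r₀ hr₀) hv⟩

/-- `[D, 1/√(1 + x²)]` is in the class (`1/√(1+x²) = 2τ/(1 + τ²)`); e.g.
`∫₀¹ dx/√(1 + x²) = log(1 + √2)`. -/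
theorem soloInformed_isKHypOne_inv_sqrt (r : IntegralRep 1)
    (hf : EqOn r.integrand (fun x => (Real.sqrt (1 + x 0 ^ 2))⁻¹) r.domain) :
    SoloInformedIsKHypOne r := by
  refine ⟨Polynomial.C (2 : algebraicClosure ℚ ℝ) * Polynomial.X, 1 + Polynomial.X ^ 2,
    fun x _ => by rw [map_add, map_one, map_pow, Polynomial.aeval_X]; positivity, fun x hx => ?_⟩
  rw [hf hx]
  show (Real.sqrt (1 + x 0 ^ 2))⁻¹ =
    (Polynomial.aeval (soloInformedHypInv (x 0)) (Polynomial.C (2 : algebraicClosure ℚ ℝ) * Polynomial.X) : ℝ) /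
      Polynomial.aeval (soloInformedHypInv (x 0)) (1 + Polynomial.X ^ 2 : (algebraicClosure ℚ ℝ)[X])
  rw [map_mul, Polynomial.aeval_C, Polynomial.aeval_X, map_add, map_one, map_pow, Polynomial.aeval_X,
    map_ofNat]
  obtain ⟨hpos, -⟩ := soloInformed_hypMap_hypInv (x 0)
  have hsq : Real.sqrt (1 + x 0 ^ 2) * Real.sqrt (1 + x 0 ^ 2) = 1 + x 0 ^ 2 :=
    Real.mul_self_sqrt (by positivity)
  have hspos : 0 < Real.sqrt (1 + x 0 ^ 2) := Real.sqrt_pos.2 (by positivity)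
  have hτ : soloInformedHypInv (x 0) = x 0 + Real.sqrt (1 + x 0 ^ 2) := rfl
  rw [hτ, eq_div_iff (by positivity), inv_mul_eq_div, div_eq_iff hspos.ne']
  nlinarith [hsq]

end Summit.KontsevichZagierPeriods.KontsevichZagierPeriods.Theorems
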